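import Literature.RepresentationTheory.Kovacevic2021.SU21UnitarityNecessary
import Literature.RepresentationTheory.Kovacevic2021.SU21GaugeExistence
import Literature.RepresentationTheory.Kovacevic2021.SU21RayWeights
import HarnessLib

/-!
# Kovačević's Theorem 4 in datum form: a strongly connected datum is unitarizable iff all edge products
# `A D'`, `B C'` are negative reals

Continuation of `Literature.RepresentationTheory.Kovacevic2021.SU21UnitarityNecessary` (unitarizable ⇔
positive weights solve three recursions; on a unitarizable datum the invariant products `A_{n,m}D_{n+1,m+3}`,
`B_{n,m}C_{n+1,m-3}` along edges of `K`-types are non-positive reals) and `SU21GaugeExistence` (two strongly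
connected data with the same `K`-types, a common vertex, square-complete `K`-type set and the same invariant
products have isomorphic modules).  [Kovacevic2021, §4 Thm 4 (proof)]: "the form is positive iff `a d < 0` and
`b c < 0`".  We prove the SUFFICIENCY of the sign conditions for strongly connected data with a vertex and a
square-complete `K`-type set, and assemble the equivalence:

* §1 product identities implied by (b30), (b35), (b40), (b45): `Q(n,m)P(n+1,m-3) = P(n,m)Q(n+1,m+3)` and
  `(n+1)² P(n,m)Q(n,m+6) = (n-1)² P(n-1,m+3)Q(n-1,m+3)` (`P = A D'`, `Q = B C'`);
* §2 the **symmetric gauge**: for a datum whose products are non-positive reals, the datum `symmDatum` with the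
  same `K`-types and arrows `A^s = √(-P)`, `D^s_{n,m} = -A^s_{n-1,m-3}`, `B^s = √(-Q)`, `C^s_{n,m} = -B^s_{n-1,m+3}`
  satisfies Kovačević's relations (b20)–(b45) and has the same products;
* §3 `symmDatum` is unitarizable, with weights `c(n,m,k) = β_n(k-1)/(n-1)!` (`SU21UnitarityCriterion`);
* §4 for a strongly connected datum the products along `K`-type edges are non-zero, so the symmetric datum is
  strongly connected too, `SU21GaugeExistence` identifies the two modules, and unitarizability transports:
  `isUnitarizable_of_products_neg`; with the necessity of `SU21UnitarityNecessary`: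
  **`isUnitarizable_iff_products_neg`**.

Definitions with bodies (`prodAD`, `prodBC`, `sqrtA`, `sqrtB`, `symmDatum`, `symmWeight`); no named facts.

## References

* D. Kovačević, *Unitary `(𝔤,K)` modules of `SU(2,1)`*, Acta Math. Spalatensia 1 (2021) 105–125
  (arXiv:1810.01752): §3 Thm 2, Remark 3; §4 Thm 4 and its proof. [Kovacevic2021]
* A. Borel, N. Wallach (2000), VI Thm 4.12 p. 133. [BorelWallach2000]
-/

noncomputable section

namespace Literature.RepresentationTheory.Kovacevic2021

-- Mathlib idiom (Mathlib/Algebra/Lie/OfAssociative.lean): commutator brackets on associative algebras; needed for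
-- the `𝔤𝔩(3,ℂ)`-module structure on `𝒟.V`, as in every file of this directory.
attribute [local instance 100] LieRing.ofAssociativeRing

namespace SU21Datum

variable (𝒟 : SU21Datum)

/-! ## §1 The invariant products and two identities among them -/

/-- the invariant product `P(n,m) = A_{n,m} D_{n+1,m+3}` of the edge `(n,m) — (n+1,m+3)` [cite: Kovacevic2021, §3 Remark 3] -/
def prodAD (n m : ℤ) : ℂ := 𝒟.A n m * 𝒟.D (n + 1) (m + 3)

/-- the invariant product `Q(n,m) = B_{n,m} C_{n+1,m-3}` of the edge `(n,m) — (n+1,m-3)` [cite: Kovacevic2021, §3 Remark 3] -/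
def prodBC (n m : ℤ) : ℂ := 𝒟.B n m * 𝒟.C (n + 1) (m - 3)

/-- `P` vanishes unless both end points are `K`-types [cite: Kovacevic2021, §3 Thm 1] -/
theorem prodAD_eq_zero {n m : ℤ} (h : (n, m) ∉ 𝒟.S ∨ (n + 1, m + 3) ∉ 𝒟.S) : 𝒟.prodAD n m = 0 := by
  rcases h with h | h
  · rw [prodAD, 𝒟.A_eq_zero h, zero_mul]
  · rw [prodAD, 𝒟.D_eq_zero h, mul_zero]

/-- `Q` vanishes unless both end points are `K`-types [cite: Kovacevic2021, §3 Thm 1] -/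
theorem prodBC_eq_zero {n m : ℤ} (h : (n, m) ∉ 𝒟.S ∨ (n + 1, m - 3) ∉ 𝒟.S) : 𝒟.prodBC n m = 0 := by
  rcases h with h | h
  · rw [prodBC, 𝒟.B_eq_zero h, zero_mul]
  · rw [prodBC, 𝒟.C_eq_zero h, mul_zero]

/-- (b30) × (b35): `Q(n,m) P(n+1,m-3) = P(n,m) Q(n+1,m+3)` (the two ways around the square with corners
`(n,m)`, `(n+1,m±3)`, `(n+2,m)`) [cite: Kovacevic2021, §3 Thm 2 (b30), (b35)] -/
theorem prodBC_mul_prodAD (n m : ℤ) :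
    𝒟.prodBC n m * 𝒟.prodAD (n + 1) (m - 3) = 𝒟.prodAD n m * 𝒟.prodBC (n + 1) (m + 3) := by
  have h30 := 𝒟.rel30 n m
  have h35 := 𝒟.rel35 (n + 2) m
  simp only [show n + 2 - 1 = n + 1 by ring] at h35
  simp only [prodAD, prodBC, show n + 1 + 1 = n + 2 by ring, sub_add_cancel, add_sub_cancel_right]
  linear_combination (𝒟.C (n + 1) (m - 3) * 𝒟.D (n + 2) m) * h30
    + (𝒟.A n m * 𝒟.B (n + 1) (m + 3)) * h35

/-- (b40) × (b45): `(n+1)² P(n,m) Q(n,m+6) = (n-1)² P(n-1,m+3) Q(n-1,m+3)` (the two ways around the square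
with corners `(n,m)`, `(n±1,m+3)`, `(n,m+6)`) [cite: Kovacevic2021, §3 Thm 2 (b40), (b45)] -/
theorem sq_mul_prodAD_mul_prodBC (n m : ℤ) :
    ((n : ℂ) + 1) ^ 2 * (𝒟.prodAD n m * 𝒟.prodBC n (m + 6))
      = ((n : ℂ) - 1) ^ 2 * (𝒟.prodAD (n - 1) (m + 3) * 𝒟.prodBC (n - 1) (m + 3)) := by
  have h40 := 𝒟.rel40 n m
  have h45 := 𝒟.rel45 n (m + 6)
  simp only [show m + 6 - 3 = m + 3 by ring] at h45
  simp only [prodAD, prodBC, show m + 6 - 3 = m + 3 by ring, show m + 3 + 3 = m + 6 by ring, sub_add_cancel,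
    add_sub_cancel_right]
  linear_combination (((n : ℂ) + 1) * (𝒟.B n (m + 6) * 𝒟.D (n + 1) (m + 3))) * h40
    + (((n : ℂ) - 1) * (𝒟.C n m * 𝒟.A (n - 1) (m + 3))) * h45

/-! ## §2 The symmetric gauge -/

/-- `√(-Re P(n,m))` [cite: Kovacevic2021, §4 proof of Thm 4] -/
def sqrtA (n m : ℤ) : ℝ := Real.sqrt (-(𝒟.prodAD n m).re)

/-- `√(-Re Q(n,m))` [cite: Kovacevic2021, §4 proof of Thm 4] -/
def sqrtB (n m : ℤ) : ℝ := Real.sqrt (-(𝒟.prodBC n m).re)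

variable {𝒟}
variable (hP : ∀ n m : ℤ, (𝒟.prodAD n m).im = 0 ∧ (𝒟.prodAD n m).re ≤ 0)
  (hQ : ∀ n m : ℤ, (𝒟.prodBC n m).im = 0 ∧ (𝒟.prodBC n m).re ≤ 0)

/-- `√(-Re P)² = -Re P` [folklore] -/
private theorem sqrtA_mul_self (hP : ∀ n m : ℤ, (𝒟.prodAD n m).im = 0 ∧ (𝒟.prodAD n m).re ≤ 0) (n m : ℤ) :
    𝒟.sqrtA n m * 𝒟.sqrtA n m = -(𝒟.prodAD n m).re :=
  Real.mul_self_sqrt (by linarith [(hP n m).2])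

/-- `√(-Re Q)² = -Re Q` [folklore] -/
private theorem sqrtB_mul_self (hQ : ∀ n m : ℤ, (𝒟.prodBC n m).im = 0 ∧ (𝒟.prodBC n m).re ≤ 0) (n m : ℤ) :
    𝒟.sqrtB n m * 𝒟.sqrtB n m = -(𝒟.prodBC n m).re :=
  Real.mul_self_sqrt (by linarith [(hQ n m).2])

/-- a real product: `P = Re P` [folklore] -/
private theorem prodAD_eq_re (hP : ∀ n m : ℤ, (𝒟.prodAD n m).im = 0 ∧ (𝒟.prodAD n m).re ≤ 0) (n m : ℤ) :
    𝒟.prodAD n m = ((𝒟.prodAD n m).re : ℂ) :=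
  Complex.ext (by simp) (by simp [(hP n m).1])

/-- a real product: `Q = Re Q` [folklore] -/
private theorem prodBC_eq_re (hQ : ∀ n m : ℤ, (𝒟.prodBC n m).im = 0 ∧ (𝒟.prodBC n m).re ≤ 0) (n m : ℤ) :
    𝒟.prodBC n m = ((𝒟.prodBC n m).re : ℂ) :=
  Complex.ext (by simp) (by simp [(hQ n m).1])

/-- `(√(-P))² = -P` in `ℂ` [folklore] -/
private theorem sqrtA_mul_sqrtA (hP : ∀ n m : ℤ, (𝒟.prodAD n m).im = 0 ∧ (𝒟.prodAD n m).re ≤ 0) (n m : ℤ) :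
    (𝒟.sqrtA n m : ℂ) * (𝒟.sqrtA n m : ℂ) = -𝒟.prodAD n m := by
  rw [← Complex.ofReal_mul, sqrtA_mul_self hP, Complex.ofReal_neg, neg_inj]
  exact (prodAD_eq_re hP n m).symm

/-- `(√(-Q))² = -Q` in `ℂ` [folklore] -/
private theorem sqrtB_mul_sqrtB (hQ : ∀ n m : ℤ, (𝒟.prodBC n m).im = 0 ∧ (𝒟.prodBC n m).re ≤ 0) (n m : ℤ) :
    (𝒟.sqrtB n m : ℂ) * (𝒟.sqrtB n m : ℂ) = -𝒟.prodBC n m := by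
  rw [← Complex.ofReal_mul, sqrtB_mul_self hQ, Complex.ofReal_neg, neg_inj]
  exact (prodBC_eq_re hQ n m).symm

/-- (b30) in the symmetric gauge: `√(-Q(n,m)) √(-P(n+1,m-3)) = √(-P(n,m)) √(-Q(n+1,m+3))`
[cite: Kovacevic2021, §3 Thm 2 (b30)] -/
theorem sqrtB_mul_sqrtA (hP : ∀ n m : ℤ, (𝒟.prodAD n m).im = 0 ∧ (𝒟.prodAD n m).re ≤ 0)
    (hQ : ∀ n m : ℤ, (𝒟.prodBC n m).im = 0 ∧ (𝒟.prodBC n m).re ≤ 0) (n m : ℤ) :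
    𝒟.sqrtB n m * 𝒟.sqrtA (n + 1) (m - 3) = 𝒟.sqrtA n m * 𝒟.sqrtB (n + 1) (m + 3) := by
  unfold sqrtA sqrtB
  rw [← Real.sqrt_mul (by linarith [(hQ n m).2]), ← Real.sqrt_mul (by linarith [(hP n m).2])]
  congr 1
  have h := 𝒟.prodBC_mul_prodAD n m
  rw [prodAD_eq_re hP n m, prodAD_eq_re hP (n + 1) (m - 3), prodBC_eq_re hQ n m, prodBC_eq_re hQ (n + 1) (m + 3)]
    at h
  have h' : (𝒟.prodBC n m).re * (𝒟.prodAD (n + 1) (m - 3)).re = (𝒟.prodAD n m).re * (𝒟.prodBC (n + 1) (m + 3)).re := by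
    exact_mod_cast h
  linear_combination h'

/-- (b40) in the symmetric gauge: `(n+1) √(-P(n,m)) √(-Q(n,m+6)) = (n-1) √(-Q(n-1,m+3)) √(-P(n-1,m+3))` for a
`K`-type `(n,m)` [cite: Kovacevic2021, §3 Thm 2 (b40), (b45)] -/
theorem sqrtA_mul_sqrtB (hP : ∀ n m : ℤ, (𝒟.prodAD n m).im = 0 ∧ (𝒟.prodAD n m).re ≤ 0)
    (hQ : ∀ n m : ℤ, (𝒟.prodBC n m).im = 0 ∧ (𝒟.prodBC n m).re ≤ 0) {n m : ℤ} (hn : 1 ≤ n) :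
    ((n : ℝ) + 1) * (𝒟.sqrtA n m * 𝒟.sqrtB n (m + 6))
      = ((n : ℝ) - 1) * (𝒟.sqrtB (n - 1) (m + 3) * 𝒟.sqrtA (n - 1) (m + 3)) := by
  have hn' : (1 : ℝ) ≤ n := by exact_mod_cast hn
  have hn1 : (0 : ℝ) ≤ (n : ℝ) + 1 := by linarith
  have hn2 : (0 : ℝ) ≤ (n : ℝ) - 1 := by linarith
  unfold sqrtA sqrtB
  rw [← Real.sqrt_mul (by linarith [(hP n m).2]), ← Real.sqrt_mul (by linarith [(hQ (n - 1) (m + 3)).2]),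
    ← Real.sqrt_sq hn1, ← Real.sqrt_sq hn2, ← Real.sqrt_mul (sq_nonneg _), ← Real.sqrt_mul (sq_nonneg _)]
  congr 1
  have h := 𝒟.sq_mul_prodAD_mul_prodBC n m
  rw [prodAD_eq_re hP n m, prodAD_eq_re hP (n - 1) (m + 3), prodBC_eq_re hQ n (m + 6),
    prodBC_eq_re hQ (n - 1) (m + 3)] at h
  have h' : ((n : ℝ) + 1) ^ 2 * ((𝒟.prodAD n m).re * (𝒟.prodBC n (m + 6)).re)
      = ((n : ℝ) - 1) ^ 2 * ((𝒟.prodAD (n - 1) (m + 3)).re * (𝒟.prodBC (n - 1) (m + 3)).re) := by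
    exact_mod_cast h
  linear_combination h'

/-- **The symmetric gauge.** For a datum whose invariant products are non-positive reals: the same `K`-types
with arrows `A^s_{n,m} = √(-P(n,m))`, `B^s_{n,m} = √(-Q(n,m))`, `C^s_{n,m} = -B^s_{n-1,m+3}`,
`D^s_{n,m} = -A^s_{n-1,m-3}`; it satisfies (b20)–(b45) and has the same invariant products.
[cite: Kovacevic2021, §3 Thm 2, Remark 3; §4 proof of Thm 4] -/
def symmDatum (𝒟 : SU21Datum) (hP : ∀ n m : ℤ, (𝒟.prodAD n m).im = 0 ∧ (𝒟.prodAD n m).re ≤ 0)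
    (hQ : ∀ n m : ℤ, (𝒟.prodBC n m).im = 0 ∧ (𝒟.prodBC n m).re ≤ 0) : SU21Datum where
  S := 𝒟.S
  A n m := (𝒟.sqrtA n m : ℂ)
  B n m := (𝒟.sqrtB n m : ℂ)
  C n m := -(𝒟.sqrtB (n - 1) (m + 3) : ℂ)
  D n m := -(𝒟.sqrtA (n - 1) (m - 3) : ℂ)
  one_le_of_mem := 𝒟.one_le_of_mem
  A_eq_zero h := by simp [sqrtA, 𝒟.prodAD_eq_zero (Or.inl h)]
  B_eq_zero h := by simp [sqrtB, 𝒟.prodBC_eq_zero (Or.inl h)]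
  C_eq_zero {n m} h := by
    have : 𝒟.prodBC (n - 1) (m + 3) = 0 :=
      𝒟.prodBC_eq_zero (Or.inr (by rw [sub_add_cancel, add_sub_cancel_right]; exact h))
    simp [sqrtB, this]
  D_eq_zero {n m} h := by
    have : 𝒟.prodAD (n - 1) (m - 3) = 0 :=
      𝒟.prodAD_eq_zero (Or.inr (by rw [sub_add_cancel, sub_add_cancel]; exact h))
    simp [sqrtA, this]
  rel20 {n m} h := by
    have e := 𝒟.rel20 h
    have e1 : (𝒟.sqrtA n m : ℂ) * -(𝒟.sqrtA (n + 1 - 1) (m + 3 - 3) : ℂ) = 𝒟.A n m * 𝒟.D (n + 1) (m + 3) := by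
      rw [add_sub_cancel_right, add_sub_cancel_right, mul_neg, sqrtA_mul_sqrtA hP, neg_neg, prodAD]
    have e2 : (𝒟.sqrtB n m : ℂ) * -(𝒟.sqrtB (n + 1 - 1) (m - 3 + 3) : ℂ) = 𝒟.B n m * 𝒟.C (n + 1) (m - 3) := by
      rw [add_sub_cancel_right, sub_add_cancel, mul_neg, sqrtB_mul_sqrtB hQ, neg_neg, prodBC]
    have e3 : -(𝒟.sqrtB (n - 1) (m + 3) : ℂ) * (𝒟.sqrtB (n - 1) (m + 3) : ℂ) = 𝒟.C n m * 𝒟.B (n - 1) (m + 3) := by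
      rw [neg_mul, sqrtB_mul_sqrtB hQ, neg_neg, prodBC, sub_add_cancel, add_sub_cancel_right, mul_comm]
    rw [e1, e2, e3]
    exact e
  rel25 {n m} h := by
    have e := 𝒟.rel25 h
    have e1 : (𝒟.sqrtA n m : ℂ) * -(𝒟.sqrtA (n + 1 - 1) (m + 3 - 3) : ℂ) = 𝒟.A n m * 𝒟.D (n + 1) (m + 3) := by
      rw [add_sub_cancel_right, add_sub_cancel_right, mul_neg, sqrtA_mul_sqrtA hP, neg_neg, prodAD]
    have e2 : (𝒟.sqrtB n m : ℂ) * -(𝒟.sqrtB (n + 1 - 1) (m - 3 + 3) : ℂ) = 𝒟.B n m * 𝒟.C (n + 1) (m - 3) := by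
      rw [add_sub_cancel_right, sub_add_cancel, mul_neg, sqrtB_mul_sqrtB hQ, neg_neg, prodBC]
    have e4 : -(𝒟.sqrtA (n - 1) (m - 3) : ℂ) * (𝒟.sqrtA (n - 1) (m - 3) : ℂ) = 𝒟.D n m * 𝒟.A (n - 1) (m - 3) := by
      rw [neg_mul, sqrtA_mul_sqrtA hP, neg_neg, prodAD, sub_add_cancel, sub_add_cancel, mul_comm]
    rw [e1, e2, e4]
    exact e
  rel30 n m := by
    have h := sqrtB_mul_sqrtA hP hQ n m
    exact_mod_cast h
  rel35 n m := by
    have h := sqrtB_mul_sqrtA hP hQ (n - 1 - 1) m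
    rw [show n - 1 - 1 + 1 = n - 1 by ring] at h
    rw [show m - 3 + 3 = m by ring, show m + 3 - 3 = m by ring, neg_mul_neg, neg_mul_neg]
    have h' : (𝒟.sqrtB (n - 1 - 1) m : ℂ) * 𝒟.sqrtA (n - 1) (m - 3) = 𝒟.sqrtA (n - 1 - 1) m * 𝒟.sqrtB (n - 1) (m + 3) := by
      exact_mod_cast h
    linear_combination h'
  rel40 n m := by
    rw [show n + 1 - 1 = n by ring, show m + 3 + 3 = m + 6 by ring]
    by_cases hS : (n, m) ∈ 𝒟.S
    · have h := sqrtA_mul_sqrtB hP hQ (m := m) (𝒟.one_le_of_mem hS)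
      have h' : ((n : ℂ) + 1) * ((𝒟.sqrtA n m : ℂ) * 𝒟.sqrtB n (m + 6))
          = ((n : ℂ) - 1) * ((𝒟.sqrtB (n - 1) (m + 3) : ℂ) * 𝒟.sqrtA (n - 1) (m + 3)) := by
        exact_mod_cast h
      linear_combination -h'
    · have h0 : 𝒟.sqrtA n m = 0 := by simp [sqrtA, 𝒟.prodAD_eq_zero (Or.inl hS)]
      have h1 : 𝒟.sqrtB (n - 1) (m + 3) = 0 := by
        have : 𝒟.prodBC (n - 1) (m + 3) = 0 :=
          𝒟.prodBC_eq_zero (Or.inr (by rw [sub_add_cancel, add_sub_cancel_right]; exact hS))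
        simp [sqrtB, this]
      rw [h0, h1]
      push_cast
      ring
  rel45 n m := by
    rw [show n + 1 - 1 = n by ring, show m - 3 - 3 = m - 6 by ring]
    by_cases hS : (n, m) ∈ 𝒟.S
    · have h := sqrtA_mul_sqrtB hP hQ (m := m - 6) (𝒟.one_le_of_mem hS)
      rw [show m - 6 + 6 = m by ring, show m - 6 + 3 = m - 3 by ring] at h
      have h' : ((n : ℂ) + 1) * ((𝒟.sqrtA n (m - 6) : ℂ) * 𝒟.sqrtB n m)
          = ((n : ℂ) - 1) * ((𝒟.sqrtB (n - 1) (m - 3) : ℂ) * 𝒟.sqrtA (n - 1) (m - 3)) := by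
        exact_mod_cast h
      linear_combination -h'
    · have h0 : 𝒟.sqrtB n m = 0 := by simp [sqrtB, 𝒟.prodBC_eq_zero (Or.inl hS)]
      have h1 : 𝒟.sqrtA (n - 1) (m - 3) = 0 := by
        have : 𝒟.prodAD (n - 1) (m - 3) = 0 :=
          𝒟.prodAD_eq_zero (Or.inr (by rw [sub_add_cancel, sub_add_cancel]; exact hS))
        simp [sqrtA, this]
      rw [h0, h1]
      push_cast
      ring

/-- the symmetric datum has the same `A D'` products [cite: Kovacevic2021, §3 Remark 3] -/
theorem symmDatum_prodAD (hP : ∀ n m : ℤ, (𝒟.prodAD n m).im = 0 ∧ (𝒟.prodAD n m).re ≤ 0)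
    (hQ : ∀ n m : ℤ, (𝒟.prodBC n m).im = 0 ∧ (𝒟.prodBC n m).re ≤ 0) (n m : ℤ) :
    (symmDatum 𝒟 hP hQ).A n m * (symmDatum 𝒟 hP hQ).D (n + 1) (m + 3) = 𝒟.A n m * 𝒟.D (n + 1) (m + 3) := by
  show (𝒟.sqrtA n m : ℂ) * -(𝒟.sqrtA (n + 1 - 1) (m + 3 - 3) : ℂ) = _
  rw [add_sub_cancel_right, add_sub_cancel_right, mul_neg, sqrtA_mul_sqrtA hP, neg_neg, prodAD]

/-- the symmetric datum has the same `B C'` products [cite: Kovacevic2021, §3 Remark 3] -/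
theorem symmDatum_prodBC (hP : ∀ n m : ℤ, (𝒟.prodAD n m).im = 0 ∧ (𝒟.prodAD n m).re ≤ 0)
    (hQ : ∀ n m : ℤ, (𝒟.prodBC n m).im = 0 ∧ (𝒟.prodBC n m).re ≤ 0) (n m : ℤ) :
    (symmDatum 𝒟 hP hQ).B n m * (symmDatum 𝒟 hP hQ).C (n + 1) (m - 3) = 𝒟.B n m * 𝒟.C (n + 1) (m - 3) := by
  show (𝒟.sqrtB n m : ℂ) * -(𝒟.sqrtB (n + 1 - 1) (m - 3 + 3) : ℂ) = _
  rw [add_sub_cancel_right, sub_add_cancel, mul_neg, sqrtB_mul_sqrtB hQ, neg_neg, prodBC]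

/-! ## §3 The symmetric datum is unitarizable -/

/-- the weights `c(n,m,k) = β_n(k-1)/(n-1)!` [cite: Kovacevic2021, §4 proof of Thm 4] -/
def symmWeight (n _m k : ℤ) : ℝ := kBeta n (k - 1).toNat / ((n - 1).toNat.factorial : ℝ)

/-- **The symmetric datum is unitarizable**: the weights `β_n(k-1)/(n-1)!` solve the three recursions of
`SU21UnitarityCriterion` (the `𝔨`-condition by the definition of `β`; the edge conditions reduce to the
telescoping identity `β_{n+1}(j)(n-j) = nβ_n(j)` because `D^s = -A^s`, `C^s = -B^s` are real).
[cite: Kovacevic2021, §4 Thm 4 (proof)] -/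
theorem symmDatum_isUnitarizable (hP : ∀ n m : ℤ, (𝒟.prodAD n m).im = 0 ∧ (𝒟.prodAD n m).re ≤ 0)
    (hQ : ∀ n m : ℤ, (𝒟.prodBC n m).im = 0 ∧ (𝒟.prodBC n m).re ≤ 0) :
    IsUnitarizable (symmDatum 𝒟 hP hQ) := by
  refine isUnitarizable_of_weights _ symmWeight ?_ ?_ ?_ ?_
  · intro n m k _ hk hkn
    exact div_pos (kBeta_pos n _ (by omega)) (by positivity)
  · intro n m k _ hk _
    unfold symmWeight
    have ht : (k + 1 - 1).toNat = (k - 1).toNat + 1 := by omega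
    have hj : (((k - 1).toNat : ℕ) : ℝ) = (k : ℝ) - 1 := by
      have h1 : (((k - 1).toNat : ℕ) : ℤ) = k - 1 := Int.toNat_of_nonneg (by omega)
      exact_mod_cast h1
    rw [ht, kBeta, hj]
    ring
  · -- the `A`–`D` edge: `(n+1-k) A^s β_{n+1}(k-1)/n! = A^s β_n(k-1)/(n-1)!`
    intro n m k hS _ hk hkn
    have hn : 1 ≤ n := 𝒟.one_le_of_mem hS
    show ((n : ℂ) + 1 - k) * starRingEnd ℂ (𝒟.sqrtA n m : ℂ) * (symmWeight (n + 1) (m + 3) k : ℂ)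
      = -(-(𝒟.sqrtA (n + 1 - 1) (m + 3 - 3) : ℂ)) * (symmWeight n m k : ℂ)
    rw [Complex.conj_ofReal, add_sub_cancel_right, add_sub_cancel_right, neg_neg]
    unfold symmWeight
    have hfac : ((n + 1 - 1).toNat.factorial : ℝ) = n * ((n - 1).toNat.factorial : ℝ) := by
      rw [show (n + 1 - 1).toNat = (n - 1).toNat + 1 by omega, Nat.factorial_succ]
      push_cast
      congr 1
      have : (((n - 1).toNat : ℕ) : ℤ) = n - 1 := Int.toNat_of_nonneg (by omega)
      have : (((n - 1).toNat : ℕ) : ℝ) = (n : ℝ) - 1 := by exact_mod_cast this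
      rw [this]; ring
    have hj : (((k - 1).toNat : ℕ) : ℝ) = (k : ℝ) - 1 := by
      have h1 : (((k - 1).toNat : ℕ) : ℤ) = k - 1 := Int.toNat_of_nonneg (by omega)
      exact_mod_cast h1
    have T := kBeta_succ_mul n (k - 1).toNat
    rw [hj] at T
    have hf0 : ((n - 1).toNat.factorial : ℝ) ≠ 0 := by positivity
    have hn' : (1 : ℝ) ≤ n := by exact_mod_cast hn
    have hn0 : (n : ℝ) ≠ 0 := by linarith
    have key : ((n : ℝ) + 1 - k) * 𝒟.sqrtA n m * (kBeta (n + 1) (k - 1).toNat / ((n + 1 - 1).toNat.factorial : ℝ))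
        = 𝒟.sqrtA n m * (kBeta n (k - 1).toNat / ((n - 1).toNat.factorial : ℝ)) := by
      rw [hfac]
      field_simp
      linear_combination 𝒟.sqrtA n m * T
    have key' := congrArg (fun x : ℝ => (x : ℂ)) key
    push_cast at key' ⊢
    exact key'
  · -- the `B`–`C` edge: `B^s β_{n-1}(k-1)/(n-2)! = (n-k) B^s β_n(k-1)/(n-1)!`
    intro n m k _ hS' hk hkn
    have hn : 2 ≤ n := by omega
    show starRingEnd ℂ (-(𝒟.sqrtB (n - 1) (m + 3) : ℂ)) * (symmWeight (n - 1) (m + 3) k : ℂ)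
      = -(((n : ℂ) - k) * (𝒟.sqrtB (n - 1) (m + 3) : ℂ)) * (symmWeight n m k : ℂ)
    rw [map_neg, Complex.conj_ofReal]
    unfold symmWeight
    have hfac : ((n - 1).toNat.factorial : ℝ) = ((n : ℝ) - 1) * ((n - 1 - 1).toNat.factorial : ℝ) := by
      rw [show (n - 1).toNat = (n - 1 - 1).toNat + 1 by omega, Nat.factorial_succ]
      push_cast
      congr 1
      have : (((n - 1 - 1).toNat : ℕ) : ℤ) = n - 1 - 1 := Int.toNat_of_nonneg (by omega)
      have : (((n - 1 - 1).toNat : ℕ) : ℝ) = (n : ℝ) - 1 - 1 := by exact_mod_cast this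
      rw [this]; ring
    have hj : (((k - 1).toNat : ℕ) : ℝ) = (k : ℝ) - 1 := by
      have h1 : (((k - 1).toNat : ℕ) : ℤ) = k - 1 := Int.toNat_of_nonneg (by omega)
      exact_mod_cast h1
    have T := kBeta_succ_mul (n - 1) (k - 1).toNat
    rw [hj, sub_add_cancel] at T
    have hf0 : ((n - 1 - 1).toNat.factorial : ℝ) ≠ 0 := by positivity
    have hn' : (2 : ℝ) ≤ n := by exact_mod_cast hn
    have hn0 : (n : ℝ) - 1 ≠ 0 := by linarith
    have key : -𝒟.sqrtB (n - 1) (m + 3) * (kBeta (n - 1) (k - 1).toNat / ((n - 1 - 1).toNat.factorial : ℝ))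
        = -(((n : ℝ) - k) * 𝒟.sqrtB (n - 1) (m + 3)) * (kBeta n (k - 1).toNat / ((n - 1).toNat.factorial : ℝ)) := by
      rw [hfac]
      field_simp
      push_cast at T
      linear_combination (𝒟.sqrtB (n - 1) (m + 3)) * T
    have key' := congrArg (fun x : ℝ => (x : ℂ)) key
    push_cast at key' ⊢
    exact key'

/-! ## §4 Kovačević's Theorem 4 for strongly connected data -/

/-- under strong connectivity a live step of `𝒟` is a live step of the symmetric datum (the products along
`K`-type edges are non-zero) [cite: Kovacevic2021, §3 Remark 3] -/
theorem symmDatum_reach (hP : ∀ n m : ℤ, (𝒟.prodAD n m).im = 0 ∧ (𝒟.prodAD n m).re ≤ 0)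
    (hQ : ∀ n m : ℤ, (𝒟.prodBC n m).im = 0 ∧ (𝒟.prodBC n m).re ≤ 0)
    (hconn : ∀ x ∈ 𝒟.S, ∀ y ∈ 𝒟.S, 𝒟.Reach x y) :
    ∀ x ∈ (symmDatum 𝒟 hP hQ).S, ∀ y ∈ (symmDatum 𝒟 hP hQ).S, (symmDatum 𝒟 hP hQ).Reach x y := by
  intro x hx y hy
  have hPne : ∀ {n m : ℤ}, (n, m) ∈ 𝒟.S → (n + 1, m + 3) ∈ 𝒟.S → 𝒟.sqrtA n m ≠ 0 := by
    intro n m h1 h2 h0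
    have hne : 𝒟.prodAD n m ≠ 0 := (A_mul_D_ne_zero_iff hconn h1).2 h2
    have hsq := sqrtA_mul_self hP n m
    rw [h0, mul_zero] at hsq
    apply hne
    rw [prodAD_eq_re hP n m, show (𝒟.prodAD n m).re = 0 by linarith, Complex.ofReal_zero]
  have hQne : ∀ {n m : ℤ}, (n, m) ∈ 𝒟.S → (n + 1, m - 3) ∈ 𝒟.S → 𝒟.sqrtB n m ≠ 0 := by
    intro n m h1 h2 h0
    have hne : 𝒟.prodBC n m ≠ 0 := (B_mul_C_ne_zero_iff hconn h1).2 h2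
    have hsq := sqrtB_mul_self hQ n m
    rw [h0, mul_zero] at hsq
    apply hne
    rw [prodBC_eq_re hQ n m, show (𝒟.prodBC n m).re = 0 by linarith, Complex.ofReal_zero]
  have hstep : ∀ a b, 𝒟.Adj a b → (symmDatum 𝒟 hP hQ).Adj a b := by
    rintro ⟨a, b⟩ c ⟨δ, hst⟩
    refine ⟨δ, ⟨hst.src_mem, hst.tgt_mem, hst.tgt_eq, ?_⟩⟩
    have h1 := hst.src_mem
    have h2 := hst.tgt_mem
    rw [hst.tgt_eq] at h2
    cases δ
    · -- `A`: coefficient `√(-P(a,b))`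
      show ((𝒟.sqrtA a b : ℝ) : ℂ) ≠ 0
      exact_mod_cast hPne h1 h2
    · -- `B`
      show ((𝒟.sqrtB a b : ℝ) : ℂ) ≠ 0
      exact_mod_cast hQne h1 h2
    · -- `C`: coefficient `-√(-Q(a-1,b+3))`
      show -((𝒟.sqrtB (a - 1) (b + 3) : ℝ) : ℂ) ≠ 0
      rw [neg_ne_zero]
      have : (a - 1 + 1, b + 3 - 3) ∈ 𝒟.S := by rw [sub_add_cancel, add_sub_cancel_right]; exact h1
      exact_mod_cast hQne h2 this
    · -- `D`: coefficient `-√(-P(a-1,b-3))`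
      show -((𝒟.sqrtA (a - 1) (b - 3) : ℝ) : ℂ) ≠ 0
      rw [neg_ne_zero]
      have : (a - 1 + 1, b - 3 + 3) ∈ 𝒟.S := by rw [sub_add_cancel, sub_add_cancel]; exact h1
      exact_mod_cast hPne h2 this
  have h := hconn x hx y hy
  unfold Reach at h ⊢
  clear hy
  induction h with
  | refl => exact Relation.ReflTransGen.refl
  | tail _ hab ih => exact Relation.ReflTransGen.tail ih (hstep _ _ hab)

/-- **Sufficiency of the sign conditions.** A strongly connected datum with a vertex `x₀` (no `K`-types at
`x₀ - (1, ±3)`), square-complete `K`-type set, and all invariant products `A D'`, `B C'` along `K`-type edges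
NEGATIVE REALS (more generally: non-positive reals everywhere) is unitarizable: it is isomorphic to its symmetric
gauge (`SU21GaugeExistence`), which carries the invariant form with weights `β_n(k-1)/(n-1)!`.
[cite: Kovacevic2021, §4 Thm 4] -/
theorem isUnitarizable_of_products_nonpos {x₀ : ℤ × ℤ} (hconn : ∀ x ∈ 𝒟.S, ∀ y ∈ 𝒟.S, 𝒟.Reach x y)
    (h₀ : x₀ ∈ 𝒟.S) (h₀D : (x₀.1 - 1, x₀.2 - 3) ∉ 𝒟.S) (h₀C : (x₀.1 - 1, x₀.2 + 3) ∉ 𝒟.S)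
    (hsq : ∀ n m : ℤ, (n, m - 3) ∈ 𝒟.S → (n, m + 3) ∈ 𝒟.S → (n + 1, m) ∈ 𝒟.S → (n - 1, m) ∈ 𝒟.S)
    (hP : ∀ n m : ℤ, (𝒟.prodAD n m).im = 0 ∧ (𝒟.prodAD n m).re ≤ 0)
    (hQ : ∀ n m : ℤ, (𝒟.prodBC n m).im = 0 ∧ (𝒟.prodBC n m).re ≤ 0) : IsUnitarizable 𝒟 := by
  obtain ⟨e⟩ := nonempty_equiv_of_products_eq (𝒟₁ := 𝒟) (𝒟₂ := symmDatum 𝒟 hP hQ) rfl hconn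
    (symmDatum_reach hP hQ hconn) h₀ h₀D h₀C hsq (fun n m => (symmDatum_prodAD hP hQ n m).symm)
    (fun n m => (symmDatum_prodBC hP hQ n m).symm)
  exact IsUnitarizable.of_equiv e (symmDatum_isUnitarizable hP hQ)

/-- **Kovačević's Theorem 4 (datum form).** For a strongly connected datum with a vertex and square-complete
`K`-type set: the module is unitarizable iff along every edge of `K`-types the invariant products
`A_{n,m} D_{n+1,m+3}` and `B_{n,m} C_{n+1,m-3}` are negative real numbers ("`a d < 0` and `b c < 0`").
[cite: Kovacevic2021, §4 Thm 4] [cite: BorelWallach2000, VI Thm 4.12] -/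
theorem isUnitarizable_iff_products_neg {x₀ : ℤ × ℤ} (hconn : ∀ x ∈ 𝒟.S, ∀ y ∈ 𝒟.S, 𝒟.Reach x y)
    (h₀ : x₀ ∈ 𝒟.S) (h₀D : (x₀.1 - 1, x₀.2 - 3) ∉ 𝒟.S) (h₀C : (x₀.1 - 1, x₀.2 + 3) ∉ 𝒟.S)
    (hsq : ∀ n m : ℤ, (n, m - 3) ∈ 𝒟.S → (n, m + 3) ∈ 𝒟.S → (n + 1, m) ∈ 𝒟.S → (n - 1, m) ∈ 𝒟.S) :
    IsUnitarizable 𝒟 ↔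
      (∀ n m : ℤ, (n, m) ∈ 𝒟.S → (n + 1, m + 3) ∈ 𝒟.S →
        (𝒟.A n m * 𝒟.D (n + 1) (m + 3)).im = 0 ∧ (𝒟.A n m * 𝒟.D (n + 1) (m + 3)).re < 0) ∧
      (∀ n m : ℤ, (n, m) ∈ 𝒟.S → (n + 1, m - 3) ∈ 𝒟.S →
        (𝒟.B n m * 𝒟.C (n + 1) (m - 3)).im = 0 ∧ (𝒟.B n m * 𝒟.C (n + 1) (m - 3)).re < 0) := by
  constructor
  · intro h
    refine ⟨fun n m hS hS' => ?_, fun n m hS hS' => ?_⟩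
    · obtain ⟨him, hre, -⟩ := prodAD_of_isUnitarizable 𝒟 h hS hS'
      refine ⟨him, lt_of_le_of_ne hre fun h0 => (A_mul_D_ne_zero_iff hconn hS).2 hS' ?_⟩
      exact Complex.ext (by simpa using h0) (by simpa using him)
    · obtain ⟨him, hre, -⟩ := prodBC_of_isUnitarizable 𝒟 h hS hS'
      refine ⟨him, lt_of_le_of_ne hre fun h0 => (B_mul_C_ne_zero_iff hconn hS).2 hS' ?_⟩
      exact Complex.ext (by simpa using h0) (by simpa using him)
  · rintro ⟨hA, hB⟩
    refine isUnitarizable_of_products_nonpos hconn h₀ h₀D h₀C hsq (fun n m => ?_) (fun n m => ?_)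
    · by_cases h : (n, m) ∈ 𝒟.S ∧ (n + 1, m + 3) ∈ 𝒟.S
      · exact ⟨(hA n m h.1 h.2).1, (hA n m h.1 h.2).2.le⟩
      · rw [𝒟.prodAD_eq_zero (not_and_or.1 h)]; simp
    · by_cases h : (n, m) ∈ 𝒟.S ∧ (n + 1, m - 3) ∈ 𝒟.S
      · exact ⟨(hB n m h.1 h.2).1, (hB n m h.1 h.2).2.le⟩
      · rw [𝒟.prodBC_eq_zero (not_and_or.1 h)]; simp

end SU21Datum

end Literature.RepresentationTheory.Kovacevic2021
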